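import Summits.Ventures.LatticeQCDFlow.TrivializingMaps.PlaquetteDecorrelation
import Literature.MathematicalPhysics.QuantumLattice.GaugeGroups

/-!
HONEST FRAMING: exact (Metropolis-corrected) sampling algorithms for lattice gauge theory; figures
of merit are autocorrelation/cost numbers at stated couplings and volumes; no continuum-physics
claim.

# U1WilsonFisherZero — EVERY FINITE-VOLUME `U(1)` WILSON PARTITION FUNCTION HAS A FISHER ZERO WITH
# `|s₀| ≤ 8` (lean-2 GEN-8, ours)

Venture-side (OURS).  Cell `lqcd-flow` (pub-lqcd), unit `pub-lqcd-lean-2-g8`, 2026-08-22.  The `U(1)`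
case (the gauge group of the cell's STEP-0 ladder, 2D `U(1)`) of `PlaquetteDecorrelation`:

* `integral_re_haar_circle`, `integral_re_sq_haar_circle` — `∫_{U(1)} Re z dz = 0`,
  `∫_{U(1)} (Re z)² dz = ½` (invariance of Haar under `z ↦ -z` and `z ↦ iz`; `(Re z)² + (Im z)² = 1`);
  `variance_re_haar_circle` — `Var_Haar(Re z) = ½` for the defining representation
  `Literature.MathematicalPhysics.QuantumLattice.u1Rep`;
* `u1_variance_wilsonAction` — `Var_{D[U]}(S_W^{U(1)}) = #plaquettes / 2` (`L ≥ 2`);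
* **`u1_wilsonZ_exists_zero_norm_le_eight`** — for every `d ≥ 2` and EVERY `L ≥ 2` the `U(1)` Wilson
  partition function `Z_L(s) = ∫ D[U] e^{-s ∑_p (1 − Re U_p)}` has a zero with `|s₀| ≤ 8`
  (`PlaquetteDecorrelation.wilsonZ_exists_zero_norm_le_uniform`: `4N / Var_Haar = 4 / ½`) — the same
  constant as `SU(2)` (Part T17); `u1_wilsonZ_integral_exists_zero_norm_le_eight` in Lüscher's
  notation.

As everywhere in the tree for the circle group, `[MeasurableSpace Circle] [BorelSpace Circle]` are
instance ARGUMENTS (Mathlib registers none).  NOT CLAIMED: `L = 1`; `β ≠ 0`; sharpness of `8`; the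
zero-free disc (see `WilsonZeroFreeKP`, every compact group); cost / autocorrelation / continuum
statements.  Literature grade (cell rule): elementary; new typing only.
-/

open MeasureTheory ProbabilityTheory Filter Topology Complex Set Metric
open Literature.MathematicalPhysics.QuantumFieldTheory
open Literature.MathematicalPhysics.QuantumFieldTheory.Luscher2010

namespace Summit.Ventures.LatticeQCDFlow.TrivializingMaps

section U1

open Literature.MathematicalPhysics.QuantumLattice (u1Rep u1Rep_apply continuous_u1Rep)

variable [MeasurableSpace Circle] [BorelSpace Circle]

omit [MeasurableSpace Circle] [BorelSpace Circle] in
/-- `Re tr (u1Rep z) = Re z`. [folklore] -/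
theorem re_trace_u1Rep (z : Circle) : ((u1Rep z).trace).re = (z : ℂ).re := by
  simp [u1Rep_apply, Matrix.trace, Matrix.scalar_apply]

/-- `∫_{U(1)} Re z dz = 0` (invariance of Haar under `z ↦ -z`). [folklore] -/
theorem integral_re_haar_circle : ∫ z : Circle, (z : ℂ).re ∂(haarProbability Circle) = 0 := by
  have h := integral_mul_left_eq_self (μ := haarProbability Circle) (fun z : Circle => (z : ℂ).re) (-1)
  have hfun : (fun z : Circle => (((-1 : Circle) * z : Circle) : ℂ).re) =
      fun z : Circle => -((z : ℂ)).re := by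
    funext z; simp
  rw [hfun, integral_neg] at h
  linarith

/-- `∫_{U(1)} (Re z)² dz = ½` (invariance of Haar under `z ↦ iz` swaps `(Re z)²` and `(Im z)²`, whose
sum is `|z|² = 1`). [folklore] -/
theorem integral_re_sq_haar_circle :
    ∫ z : Circle, (z : ℂ).re ^ 2 ∂(haarProbability Circle) = 1 / 2 := by
  set μ := haarProbability Circle with hμ
  have hI : ((Circle.exp (Real.pi / 2) : Circle) : ℂ) = Complex.I := by
    rw [Circle.coe_exp]
    push_cast
    exact Complex.exp_pi_div_two_mul_I
  -- `∫ (Re z)² = ∫ (Im z)²`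
  have h := integral_mul_left_eq_self (μ := μ) (fun z : Circle => (z : ℂ).re ^ 2)
    (Circle.exp (Real.pi / 2))
  have hfun : (fun z : Circle => (((Circle.exp (Real.pi / 2) * z : Circle)) : ℂ).re ^ 2) =
      fun z : Circle => ((z : ℂ)).im ^ 2 := by
    funext z
    rw [Circle.coe_mul, hI, Complex.I_mul_re, neg_sq]
  rw [hfun] at h
  -- `(Re z)² + (Im z)² = 1`
  have hsum : ∀ z : Circle, (z : ℂ).re ^ 2 + (z : ℂ).im ^ 2 = 1 := fun z => by
    have h1 : Complex.normSq (z : ℂ) = 1 := by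
      rw [Complex.normSq_eq_norm_sq, Circle.norm_coe, one_pow]
    rw [Complex.normSq_apply] at h1
    nlinarith [h1]
  have hrec : Continuous fun z : Circle => ((z : ℂ)).re ^ 2 := by fun_prop
  have himc : Continuous fun z : Circle => ((z : ℂ)).im ^ 2 := by fun_prop
  have hre : Integrable (fun z : Circle => (z : ℂ).re ^ 2) μ :=
    (BoundedContinuousFunction.mkOfCompact ⟨_, hrec⟩).integrable μ
  have him : Integrable (fun z : Circle => (z : ℂ).im ^ 2) μ :=
    (BoundedContinuousFunction.mkOfCompact ⟨_, himc⟩).integrable μ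
  have htot : ∫ z : Circle, (z : ℂ).re ^ 2 ∂μ + ∫ z : Circle, (z : ℂ).im ^ 2 ∂μ = 1 := by
    rw [← integral_add hre him]
    simp_rw [hsum]
    rw [integral_const, smul_eq_mul, probReal_univ, one_mul]
  linarith

/-- **`Var_Haar(Re z) = ½` on `U(1)`.** [folklore] -/
theorem variance_re_haar_circle :
    variance (fun z : Circle => ((u1Rep z).trace).re) (haarProbability Circle) = 1 / 2 := by
  simp_rw [re_trace_u1Rep]
  have hc : Continuous fun z : Circle => (z : ℂ).re := Complex.continuous_re.comp continuous_subtype_val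
  have hm : MemLp (fun z : Circle => (z : ℂ).re) 2 (haarProbability Circle) :=
    MemLp.of_bound hc.aestronglyMeasurable 1 (ae_of_all _ fun z => by
      rw [Real.norm_eq_abs]
      exact (Complex.abs_re_le_norm (z : ℂ)).trans (Circle.norm_coe z).le)
  rw [← covariance_self hc.aemeasurable, covariance_eq_sub hm hm]
  have h2 : ∫ z : Circle, (z : ℂ).re * (z : ℂ).re ∂(haarProbability Circle) = 1 / 2 := by
    simp_rw [← sq]; exact integral_re_sq_haar_circle
  simp only [Pi.mul_apply, h2, integral_re_haar_circle]
  norm_num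

/-- **EVERY FINITE-VOLUME `U(1)` WILSON PARTITION FUNCTION HAS A FISHER ZERO WITH `|s₀| ≤ 8`**
(`d ≥ 2`, `L ≥ 2`; `Z_L(s) = ∫ D[U] e^{-s ∑_p (1 - Re U_p)}`). [ours] -/
theorem u1_wilsonZ_exists_zero_norm_le_eight {d L : ℕ} [NeZero L] (hd : 2 ≤ d) (hL : 2 ≤ L) :
    ∃ s₀ : ℂ, ‖s₀‖ ≤ 8 ∧
      complexMGF (fun U => -wilsonAction u1Rep U) (trivialMeasure Circle d L) s₀ = 0 := by
  have hv : 0 < variance (fun z : Circle => ((u1Rep z).trace).re) (haarProbability Circle) := by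
    rw [variance_re_haar_circle]; norm_num
  obtain ⟨s₀, hs₀, hz⟩ :=
    wilsonZ_exists_zero_norm_le_uniform (d := d) (L := L) u1Rep continuous_u1Rep hd hL hv
  refine ⟨s₀, ?_, hz⟩
  rw [variance_re_haar_circle] at hs₀
  norm_num at hs₀
  exact hs₀

/-- Lüscher's notation: a zero of `s ↦ ∫ D[U] e^{-sS_W^{U(1)}}` with `|s₀| ≤ 8`, every `L ≥ 2`. [ours] -/
theorem u1_wilsonZ_integral_exists_zero_norm_le_eight {d L : ℕ} [NeZero L] (hd : 2 ≤ d)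
    (hL : 2 ≤ L) :
    ∃ s₀ : ℂ, ‖s₀‖ ≤ 8 ∧
      ∫ U, cexp (-(s₀ * (wilsonAction u1Rep U : ℂ))) ∂(trivialMeasure Circle d L) = 0 := by
  obtain ⟨s₀, hs₀, hz⟩ := u1_wilsonZ_exists_zero_norm_le_eight (d := d) (L := L) hd hL
  exact ⟨s₀, hs₀, by rw [← WilsonPinching.complexMGF_neg_wilsonAction u1Rep s₀]; exact hz⟩

/-- **`Var_{D[U]}(S_W^{U(1)}) = #plaquettes / 2`** (`L ≥ 2`). [ours] -/
theorem u1_variance_wilsonAction {d L : ℕ} [NeZero L] (hL : 2 ≤ L) :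
    variance (wilsonAction (d := d) (L := L) u1Rep) (trivialMeasure Circle d L) =
      Fintype.card (Plaquette d L) / 2 := by
  rw [variance_wilsonAction_eq_card_mul u1Rep continuous_u1Rep hL, variance_re_haar_circle]
  ring

end U1

end Summit.Ventures.LatticeQCDFlow.TrivializingMaps
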